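import Summits.AtomisticToContinuum.Crystallization.Theorems.FrustratedLawDichotomyStrainedPatchHomEntrySign

/-!
# SIX-COORDINATE fcc search: the lower-triangle entries are never bisected (self-adjointness), removing the `asymOK` straddling overhead

decomp-a2c hand-1 g21 (crux `AperiodicFrustratedLawGap`, stmt-AtomisticToContinuum-27623; critic row 828 (B)(4) «E-SYM: the entry cube is 9-dimensional but
`hfcc` ranges over SELF-ADJOINT `U` (6 free entries); `asymOK` prunes boxes off the diagonal `u_ab = u_ba` but every box touching the diagonal survives at
every scale (≈ ×2–3 leaves per mirrored pair at fine scales, up to ≈ ×8–27 overall); a 6-coordinate driver is a small variant»).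

The variant, WITHOUT a new driver: keep hand-2's 9-coordinate boxes and root cube, but evaluate any leaf verdict on the SYMMETRISED box — the lower-triangle
coordinates `(a, b)`, `a > b`, are replaced by their mirror `(b, a)` (`symIdx`) — and let the selector `rr6` bisect only the six upper coordinates.  For a
self-adjoint `U` with entries in the box, the entries also lie in the symmetrised box (`u_ab = u_ba`, `…HomEntryTable.entries_symm`), so a verdict that is
sound in the (domain-relativised) `hver` sense stays sound after symmetrisation (★ `sym_hver`).  Instances: `entryLeafOK6 μ := entryLeafOKD μ ∘ sym`
(sign ∨ sort ∨ fit ∨ symmetry ∨ column ∨ TABLE on the symmetrised box), ★★ `fccHalf_of_entrySearch6`, ★★★ `homFloor_of_entrySearches6`.  The lower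
coordinates keep their root half-width `SC/4` forever and are simply ignored.

0 sorry; standard axioms; no instances / notation / `#eval`.  `--supports stmt-AtomisticToContinuum-27623`.
-/

namespace Summit.AtomisticToContinuum.Crystallization.Theorems.FrustratedLawDichotomyStrainedPatchHomEntrySix

open scoped BigOperators RealInnerProductSpace
open Literature.Analysis.ValidatedNumerics.Numerics
open Summit.AtomisticToContinuum.Crystallization.Theorems.ChargedEnergyGapNegative (E3)
open Summit.AtomisticToContinuum.Crystallization.Theorems.FrustratedLawDichotomySchurCut (effPot w₄₅ ω₄)
open Summit.AtomisticToContinuum.Crystallization.Theorems.FrustratedLawDichotomyAveragingRuleTightFree (TightNearCap BadNearCap)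
open Summit.AtomisticToContinuum.Crystallization.Theorems.FrustratedLawDichotomyExemptAbsorption (ExemptNear)
open Summit.AtomisticToContinuum.Crystallization.Theorems.FrustratedLawDichotomyStrainedPatchHomSplit
open Summit.AtomisticToContinuum.Crystallization.Theorems.FrustratedLawDichotomyStrainedPatchHomPrunedPolar (homFloor_of_prunedBoxSums_selfAdjoint)
open Summit.AtomisticToContinuum.Crystallization.Theorems.FrustratedLawDichotomyStrainedPatchHomCertTree (CertTree treeOK)
open Summit.AtomisticToContinuum.Crystallization.Theorems.FrustratedLawDichotomyStrainedPatchHomEntryGram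
open Summit.AtomisticToContinuum.Crystallization.Theorems.FrustratedLawDichotomyStrainedPatchHomEntryGramHcp (rootCH rootWH)
open Summit.AtomisticToContinuum.Crystallization.Theorems.FrustratedLawDichotomyStrainedPatchHomEntryFitHcp (entryLeafOKH2 entryLeafOKH2_sound)
open Summit.AtomisticToContinuum.Crystallization.Theorems.FrustratedLawDichotomyStrainedPatchHomEntryTable (entries_symm muRec)
open Summit.AtomisticToContinuum.Crystallization.Theorems.FrustratedLawDichotomyStrainedPatchHomEntrySearch
open Summit.AtomisticToContinuum.Crystallization.Theorems.FrustratedLawDichotomyStrainedPatchHomEntrySym (entryLeafOKS_sound)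
open Summit.AtomisticToContinuum.Crystallization.Theorems.FrustratedLawDichotomyStrainedPatchHomEntrySign
open Literature.Barriers.AtomisticToContinuum.FlatleyTheil2015 (fccVec)

/-! ## §1. Symmetrisation of a box -/

/-- Mirror a lower-triangle coordinate onto the upper triangle: `(a, b) ↦ (min, max)`. -/
def symIdx (ab : Fin 3 × Fin 3) : Fin 3 × Fin 3 := if ab.1 ≤ ab.2 then ab else (ab.2, ab.1)

/-- `symIdx` is the identity on the upper triangle and the diagonal. [formal bookkeeping] -/
theorem symIdx_of_le {ab : Fin 3 × Fin 3} (h : ab.1 ≤ ab.2) : symIdx ab = ab := if_pos h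

/-- `symIdx` mirrors the lower triangle. [formal bookkeeping] -/
theorem symIdx_of_not_le {ab : Fin 3 × Fin 3} (h : ¬ ab.1 ≤ ab.2) : symIdx ab = (ab.2, ab.1) := if_neg h

/-- ★ A self-adjoint `U` with entries in the box `(c, w)` has its entries in the SYMMETRISED box `(c ∘ symIdx, w ∘ symIdx)`. [folklore] -/
theorem hbox_sym {U : E3 →L[ℝ] E3} (hsa : ∀ v v' : E3, ⟪U v, v'⟫ = ⟪v, U v'⟫) {c w : Fin 3 × Fin 3 → ℤ}
    (hbox : ∀ ab : Fin 3 × Fin 3, |(U (EuclideanSpace.single ab.2 (1 : ℝ))) ab.1 - (c ab : ℝ) / SC| ≤ (w ab : ℝ) / SC) (ab : Fin 3 × Fin 3) :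
    |(U (EuclideanSpace.single ab.2 (1 : ℝ))) ab.1 - (c (symIdx ab) : ℝ) / SC| ≤ (w (symIdx ab) : ℝ) / SC := by
  by_cases h : ab.1 ≤ ab.2
  · rw [symIdx_of_le h]; exact hbox ab
  · rw [symIdx_of_not_le h, entries_symm hsa ab.1 ab.2]
    exact hbox (ab.2, ab.1)

/-- ★ **SYMMETRISATION PRESERVES SOUNDNESS** (domain-relativised `hver` shape of `…HomEntrySign.fccHalf_of_entryTreeDom`): if `verdict` is sound, so is
`fun c w => verdict (c ∘ symIdx) (w ∘ symIdx)`. [folklore] -/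
theorem sym_hver {μ : ℤ} (verdict : (Fin 3 × Fin 3 → ℤ) → (Fin 3 × Fin 3 → ℤ) → Bool)
    (hver : ∀ c w, verdict c w = true → ∀ U : E3 →L[ℝ] E3, (∀ v v' : E3, ⟪U v, v'⟫ = ⟪v, U v'⟫) → ‖U - 1‖ ≤ 1 / 4 →
      (∀ ab : Fin 3 × Fin 3, |(U (EuclideanSpace.single ab.2 (1 : ℝ))) ab.1 - (c ab : ℝ) / SC| ≤ (w ab : ℝ) / SC) →
      (U (EuclideanSpace.single 1 (1 : ℝ))) 1 ≤ (U (EuclideanSpace.single 0 (1 : ℝ))) 0 →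
      (U (EuclideanSpace.single 2 (1 : ℝ))) 2 ≤ (U (EuclideanSpace.single 1 (1 : ℝ))) 1 →
      0 ≤ (U (EuclideanSpace.single 1 (1 : ℝ))) 0 → 0 ≤ (U (EuclideanSpace.single 2 (1 : ℝ))) 0 →
      (∀ (M : ℕ) (z : Fin M → E3) (c : Fin M), Function.Injective z →
          Set.range z = {x : E3 | dist x (z c) ≤ 133 / 10 ∧ ∃ a : Fin 3 → ℤ, x = z c + latPt U fccVec a} →
          TightNearCap (9 / 5) (3 / 2) z c ∨ ExemptNear (9 / 5) ExRec z c ∨ BadNearCap (9 / 5) (3 / 2) z c) ∨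
        (μ : ℝ) / SC ≤ ∑ b ∈ (Fintype.piFinset fun _ : Fin 3 => Finset.Icc (-7 : ℤ) 7).filter (fun b => b ≠ 0),
          effPot w₄₅ ω₄ (3 / 400) ‖latPt U fccVec b‖) :
    ∀ c w, verdict (c ∘ symIdx) (w ∘ symIdx) = true → ∀ U : E3 →L[ℝ] E3, (∀ v v' : E3, ⟪U v, v'⟫ = ⟪v, U v'⟫) → ‖U - 1‖ ≤ 1 / 4 →
      (∀ ab : Fin 3 × Fin 3, |(U (EuclideanSpace.single ab.2 (1 : ℝ))) ab.1 - (c ab : ℝ) / SC| ≤ (w ab : ℝ) / SC) →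
      (U (EuclideanSpace.single 1 (1 : ℝ))) 1 ≤ (U (EuclideanSpace.single 0 (1 : ℝ))) 0 →
      (U (EuclideanSpace.single 2 (1 : ℝ))) 2 ≤ (U (EuclideanSpace.single 1 (1 : ℝ))) 1 →
      0 ≤ (U (EuclideanSpace.single 1 (1 : ℝ))) 0 → 0 ≤ (U (EuclideanSpace.single 2 (1 : ℝ))) 0 →
      (∀ (M : ℕ) (z : Fin M → E3) (c : Fin M), Function.Injective z →
          Set.range z = {x : E3 | dist x (z c) ≤ 133 / 10 ∧ ∃ a : Fin 3 → ℤ, x = z c + latPt U fccVec a} →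
          TightNearCap (9 / 5) (3 / 2) z c ∨ ExemptNear (9 / 5) ExRec z c ∨ BadNearCap (9 / 5) (3 / 2) z c) ∨
        (μ : ℝ) / SC ≤ ∑ b ∈ (Fintype.piFinset fun _ : Fin 3 => Finset.Icc (-7 : ℤ) 7).filter (fun b => b ≠ 0),
          effPot w₄₅ ω₄ (3 / 400) ‖latPt U fccVec b‖ :=
  fun c w hv U hsa hU hbox h1 h2 h01 h02 => hver (c ∘ symIdx) (w ∘ symIdx) hv U hsa hU (fun ab => hbox_sym hsa hbox ab) h1 h2 h01 h02

/-! ## §2. The six-coordinate verdict, selector, and the `(H)` theorems -/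

/-- Soundness of `entryLeafOKD` in the domain-relativised `hver` shape (the inline argument of `…HomEntrySign.fccHalf_of_entrySearchDom`). [folklore] -/
theorem entryLeafOKD_sound {μ : ℤ} {c w : Fin 3 × Fin 3 → ℤ} (h : entryLeafOKD μ c w = true) (U : E3 →L[ℝ] E3)
    (hsa : ∀ v v' : E3, ⟪U v, v'⟫ = ⟪v, U v'⟫) (hU : ‖U - 1‖ ≤ 1 / 4)
    (hbox : ∀ ab : Fin 3 × Fin 3, |(U (EuclideanSpace.single ab.2 (1 : ℝ))) ab.1 - (c ab : ℝ) / SC| ≤ (w ab : ℝ) / SC)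
    (h1 : (U (EuclideanSpace.single 1 (1 : ℝ))) 1 ≤ (U (EuclideanSpace.single 0 (1 : ℝ))) 0)
    (h2 : (U (EuclideanSpace.single 2 (1 : ℝ))) 2 ≤ (U (EuclideanSpace.single 1 (1 : ℝ))) 1)
    (h01 : 0 ≤ (U (EuclideanSpace.single 1 (1 : ℝ))) 0) (h02 : 0 ≤ (U (EuclideanSpace.single 2 (1 : ℝ))) 0) :
    (∀ (M : ℕ) (z : Fin M → E3) (c : Fin M), Function.Injective z →
        Set.range z = {x : E3 | dist x (z c) ≤ 133 / 10 ∧ ∃ a : Fin 3 → ℤ, x = z c + latPt U fccVec a} →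
        TightNearCap (9 / 5) (3 / 2) z c ∨ ExemptNear (9 / 5) ExRec z c ∨ BadNearCap (9 / 5) (3 / 2) z c) ∨
      (μ : ℝ) / SC ≤ ∑ b ∈ (Fintype.piFinset fun _ : Fin 3 => Finset.Icc (-7 : ℤ) 7).filter (fun b => b ≠ 0),
        effPot w₄₅ ω₄ (3 / 400) ‖latPt U fccVec b‖ := by
  simp only [entryLeafOKD, Bool.or_eq_true] at h
  rcases h with h | h
  · exact (false_of_signOut h (u := fun ab : Fin 3 × Fin 3 => (U (EuclideanSpace.single ab.2 (1 : ℝ))) ab.1) hbox h01 h02).elim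
  · exact entryLeafOKS_sound h U hsa hU hbox h1 h2

/-- ★ **THE SIX-COORDINATE fcc VERDICT**: `entryLeafOKD μ` (sign ∨ sort ∨ fit ∨ symmetry ∨ column ∨ table) on the symmetrised box. -/
def entryLeafOK6 (μ : ℤ) (c w : Fin 3 × Fin 3 → ℤ) : Bool := entryLeafOKD μ (c ∘ symIdx) (w ∘ symIdx)

/-- The six bisected coordinates: diagonal first, then the upper off-diagonal entries. -/
def order6 : List (Fin 3 × Fin 3) := [(0, 0), (1, 1), (2, 2), (0, 1), (0, 2), (1, 2)]

/-- ★ Selector for the six-coordinate search: widest UPPER coordinate (the lower-triangle coordinates are never bisected). -/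
def rr6 : ℕ → (Fin 3 × Fin 3 → ℤ) → (Fin 3 × Fin 3 → ℤ) → Fin 3 × Fin 3 := fun _ _ w => pick (0, 0) order6 w

/-- ★★ **THE fcc HALF FROM ONE SIX-COORDINATE SEARCH** (fundamental domain, symmetrised boxes, any selector/fuel/start depth). [folklore] -/
theorem fccHalf_of_entrySearch6 {m : ℝ} {μ : ℤ} (hμ : 2 * (m + (-(7175 / 10000) + 3 / 400)) * SC ≤ μ)
    {sel : ℕ → (Fin 3 × Fin 3 → ℤ) → (Fin 3 × Fin 3 → ℤ) → Fin 3 × Fin 3} {fuel d : ℕ}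
    (h : searchOK (entryLeafOK6 μ) sel fuel d rootC rootW = true) :
    ∀ U : E3 →L[ℝ] E3, (∀ v w : E3, inner ℝ (U v) w = inner ℝ v (U w)) → (∀ w : E3, 0 ≤ inner ℝ w (U w)) → ‖U - 1‖ ≤ 1 / 4 →
      (∀ (M : ℕ) (z : Fin M → E3) (c : Fin M), Function.Injective z →
          Set.range z = {x : E3 | dist x (z c) ≤ 133 / 10 ∧ ∃ a : Fin 3 → ℤ, x = z c + latPt U fccVec a} →
          TightNearCap (9 / 5) (3 / 2) z c ∨ ExemptNear (9 / 5) ExRec z c ∨ BadNearCap (9 / 5) (3 / 2) z c) ∨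
      m ≤ (∑ b ∈ (Fintype.piFinset fun _ : Fin 3 => Finset.Icc (-7 : ℤ) 7).filter (fun b => b ≠ 0),
        effPot w₄₅ ω₄ (3 / 400) ‖latPt U fccVec b‖) / 2 - (-(7175 / 10000) + 3 / 400) := by
  obtain ⟨t, ht⟩ := exists_tree_of_searchOK (entryLeafOK6 μ) sel fuel d rootC rootW h
  exact fccHalf_of_entryTreeDom hμ (entryLeafOK6 μ)
    (sym_hver (entryLeafOKD μ) fun c w hv U hsa hU hbox h1 h2 h01 h02 => entryLeafOKD_sound hv U hsa hU hbox h1 h2 h01 h02) ht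

/-- ★★★ **`(H) HomFloor m` FROM TWO SEARCH BOOLEANS, six-coordinate fcc search over the fundamental domain**; hcp side hand-2's `entryLeafOKH2 μ`.
[folklore] -/
theorem homFloor_of_entrySearches6 {m : ℝ} {μ : ℤ} (hμ : 2 * (m + (-(7175 / 10000) + 3 / 400)) * SC ≤ μ)
    {selF : ℕ → (Fin 3 × Fin 3 → ℤ) → (Fin 3 × Fin 3 → ℤ) → Fin 3 × Fin 3} {fuelF dF : ℕ}
    (hF : searchOK (entryLeafOK6 μ) selF fuelF dF rootC rootW = true)
    {selH : ℕ → ((Fin 3 × Fin 3) ⊕ Fin 3 → ℤ) → ((Fin 3 × Fin 3) ⊕ Fin 3 → ℤ) → (Fin 3 × Fin 3) ⊕ Fin 3} {fuelH dH : ℕ}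
    (hH : searchOK (entryLeafOKH2 μ) selH fuelH dH rootCH rootWH = true) : HomFloor m :=
  homFloor_of_prunedBoxSums_selfAdjoint (fccHalf_of_entrySearch6 hμ hF)
    (hcpHalf_of_entrySearch hμ (entryLeafOKH2 μ) (fun _ _ hv U ξ hsa hU hbox hξ => entryLeafOKH2_sound hv U ξ hsa hU hbox hξ) hH)

/-! ## §3. Kernel smoke tests -/

/-- `rr6` starts on `(0,0)`, then moves to the other diagonal entries, and never selects a lower-triangle coordinate even when it is the widest;
the six-coordinate verdict sees the mirrored upper entry: a box whose LOWER entry `(1,0)` alone is off is still accepted at depth 0 near `0.97·1`. -/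
example : rr6 0 rootC rootW = (0, 0) ∧ rr6 0 rootC (Function.update rootW (0, 0) 0) = (1, 1) ∧
    rr6 0 rootC (Function.update rootW (1, 0) (4 * rootW (1, 0))) = (0, 0) ∧
    entryLeafOK6 muRec (Function.update (fun ab : Fin 3 × Fin 3 => if ab.1 = ab.2 then (273030727409336 : ℤ) else 0) (1, 0) 99999999999999)
      (fun _ => 1099511627776) = true := by
  decide +kernel

/-! ## §4. The milli target (appended, hand-1 g21) -/

/-- The record target for `m = 1/1000` (the milli seam `…HomSplit.seam_arith_milli`): `μ_milli = ⌈2 (1/1000 + e_W) · SC⌉ = −399131516975710`. -/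
def muMilli : ℤ := -399131516975710

/-- `μ_milli` satisfies the hypothesis `2 (m + e_W) SC ≤ μ` of the tree / search theorems at `m = 1/1000`. [formal bookkeeping] -/
theorem muMilli_ok : 2 * ((1 : ℝ) / 1000 + (-(7175 / 10000) + 3 / 400)) * SC ≤ (muMilli : ℝ) := by
  norm_num [muMilli, SC]

/-- ★★★ `HomFloor (1/1000)` from the two searches at `μ_milli` (six-coordinate fcc search over the fundamental domain; hcp `entryLeafOKH2`). [folklore] -/
theorem homFloor_milli_of_entrySearches6
    {selF : ℕ → (Fin 3 × Fin 3 → ℤ) → (Fin 3 × Fin 3 → ℤ) → Fin 3 × Fin 3} {fuelF dF : ℕ}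
    (hF : searchOK (entryLeafOK6 muMilli) selF fuelF dF rootC rootW = true)
    {selH : ℕ → ((Fin 3 × Fin 3) ⊕ Fin 3 → ℤ) → ((Fin 3 × Fin 3) ⊕ Fin 3 → ℤ) → (Fin 3 × Fin 3) ⊕ Fin 3} {fuelH dH : ℕ}
    (hH : searchOK (entryLeafOKH2 muMilli) selH fuelH dH rootCH rootWH = true) : HomFloor (1 / 1000) :=
  homFloor_of_entrySearches6 muMilli_ok hF hH

/-- ★★★ `HomFloor (1/625)` from the two searches at `μ⋆ = muRec`. [folklore] -/
theorem homFloor_625_of_entrySearches6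
    {selF : ℕ → (Fin 3 × Fin 3 → ℤ) → (Fin 3 × Fin 3 → ℤ) → Fin 3 × Fin 3} {fuelF dF : ℕ}
    (hF : searchOK (entryLeafOK6 muRec) selF fuelF dF rootC rootW = true)
    {selH : ℕ → ((Fin 3 × Fin 3) ⊕ Fin 3 → ℤ) → ((Fin 3 × Fin 3) ⊕ Fin 3 → ℤ) → (Fin 3 × Fin 3) ⊕ Fin 3} {fuelH dH : ℕ}
    (hH : searchOK (entryLeafOKH2 muRec) selH fuelH dH rootCH rootWH = true) : HomFloor (1 / 625) :=
  homFloor_of_entrySearches6 FrustratedLawDichotomyStrainedPatchHomEntryTable.muRec_ok hF hH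

end Summit.AtomisticToContinuum.Crystallization.Theorems.FrustratedLawDichotomyStrainedPatchHomEntrySix
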